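import Summits.HodgeConjecture.CorCM.Model.BlockGysin
import Summits.HodgeConjecture.CorCM.Model.ProdFinTopClass
import Summits.HodgeConjecture.CorCM.StubTree.Qw8GeometricBlocks
import HarnessLib

/-!
# COR-CM model layer: fact F7 `Fact_gysin` holds in the Picard–CM model universe (row Fg7)

Cell `pub-hodgecm2` (COR-CM), seat `b25` (binder prover for row Fg7 of `BINDER-OWNERS.md`).  The stage-1 fact F7
`Universe.Fact_gysin` (`CorCM/StubTree/Qw8GeometricBlocks.lean`; consumed by [QW8] Thm 2.5,
`qw8Sufficiency_of_geometricFacts`) asks, for every concatenated CM product `P = ∏_k A_{Ξ_k}` and every block pair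
`(p_A, p_B)` (`IsBlockPair`: pull-back compatibilities with the factor projections `prj`), for Gysin maps
`gy k : H^{k + 2 dim Y'}(P; ℚ) → H^k(Y; ℚ)` which (i) preserve algebraic classes (codimension shift `dim Y'`) and
(ii) satisfy `gy k (p_A^* e ∪ p_B^* ω) = tr_{Y'}(ω) • e`.

For the model universe `Model.universeOf hHD hI hU h₃` this is a THEOREM with no further hypothesis
(`universeOf_fact_gysin`): the block Gysin theorem `Model.exists_blockGysin` (`CorCM/Model/BlockGysin`) applies, its
hypothesis `p_A^* e ∪ p_B^* ω ≠ 0` being `Model.blockPair_top_ne_zero` (`CorCM/Model/ProdFinTopClass`) instantiated at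
the package's factor projections `Universe.prj` (whose three pull-back equations hold by unfolding), and its
dimension hypothesis being `Model.dim_prodFin_blocks`; clause (i) is transported along the package's degree cast
`Universe.castCoh` (`ofRatClass_castCoh_mem_iff`, by `subst`).
-/

noncomputable section

open CategoryTheory MonoidalCategory CartesianMonoidalCategory
open Literature.AlgebraicTopology.SingularHomology
open Literature.AlgebraicGeometry.Motives (SchemeOver ComplexPoints IsSmoothProjective bettiCohomology bettiCup CMType)
open Literature.AlgebraicGeometry.HodgeTheory
open Literature.NumberTheory.Automorphic.PicardCM

namespace Summit.HodgeConjecture.CorCM.Model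

section Projections

variable (hHD : exists_isReal_hodgeModel) (hI : hodgePQ_independent_of_hodgeModel)
  (hU : BallQuotientUniformisedDatum) (h₃ : CMAbelianVarietyRealised)

/-- `prj_0^* = id` for a one-fold product of the model universe (the hypothesis `hpr0` of
`Model.blockPair_top_ne_zero` for `pr := Universe.prj`). -/
theorem pull_prj_zero (X : Fin (0 + 1) → Var) (k : ℕ) :
    BettiUniverse.pull ((universeOf hHD hI hU h₃).prj 0 X 0) k = LinearMap.id := by
  have e : (universeOf hHD hI hU h₃).prj 0 X 0 = 𝟙 (Var.scheme hU h₃ (X 0)) := by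
    show (universeOf hHD hI hU h₃).prj 0 X (Fin.last 0) = _
    simp only [Universe.prj, Fin.lastCases_last]
    rfl
  exact (congrArg (BettiUniverse.pull · k) e).trans (BettiUniverse.pull_id _ k)

/-- `prj_{last}^* = snd^*` for an `(n+2)`-fold product of the model universe (hypothesis `hprL`; implicit arguments
pinned to `prodFin (n+1) X`). -/
theorem pull_prj_last (n : ℕ) (X : Fin (n + 1 + 1) → Var) (k : ℕ) :
    BettiUniverse.pull ((universeOf hHD hI hU h₃).prj (n + 1) X (Fin.last (n + 1))) k =
      BettiUniverse.pull (X := Var.scheme hU h₃ ((universeOf hHD hI hU h₃).prodFin (n + 1) X))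
        (Y := Var.scheme hU h₃ (X (Fin.last (n + 1))))
        (snd (Var.scheme hU h₃ ((universeOf hHD hI hU h₃).prodFin n fun i => X i.castSucc))
          (Var.scheme hU h₃ (X (Fin.last (n + 1))))) k := by
  have e : (universeOf hHD hI hU h₃).prj (n + 1) X (Fin.last (n + 1)) =
      (snd (Var.scheme hU h₃ ((universeOf hHD hI hU h₃).prodFin n fun i => X i.castSucc))
          (Var.scheme hU h₃ (X (Fin.last (n + 1)))) :
        Var.Mor hU h₃ ((universeOf hHD hI hU h₃).prodFin (n + 1) X) (X (Fin.last (n + 1)))) := by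
    simp [Universe.prj]
    rfl
  exact congrArg (BettiUniverse.pull · k) e

/-- `prj_{castSucc i}^* = fst^* ∘ prj_i^*` for an `(n+2)`-fold product of the model universe (hypothesis `hprC`;
implicit arguments pinned to `prodFin (n+1) X`). -/
theorem pull_prj_castSucc (n : ℕ) (X : Fin (n + 1 + 1) → Var) (i : Fin (n + 1)) (k : ℕ) :
    BettiUniverse.pull ((universeOf hHD hI hU h₃).prj (n + 1) X i.castSucc) k =
      BettiUniverse.pull (X := Var.scheme hU h₃ ((universeOf hHD hI hU h₃).prodFin (n + 1) X))
          (Y := Var.scheme hU h₃ ((universeOf hHD hI hU h₃).prodFin n fun i => X i.castSucc))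
          (fst (Var.scheme hU h₃ ((universeOf hHD hI hU h₃).prodFin n fun i => X i.castSucc))
            (Var.scheme hU h₃ (X (Fin.last (n + 1))))) k ∘ₗ
        BettiUniverse.pull ((universeOf hHD hI hU h₃).prj n (fun i => X i.castSucc) i) k := by
  have e : (universeOf hHD hI hU h₃).prj (n + 1) X i.castSucc =
      (fst (Var.scheme hU h₃ ((universeOf hHD hI hU h₃).prodFin n fun i => X i.castSucc))
          (Var.scheme hU h₃ (X (Fin.last (n + 1)))) :
        Var.Mor hU h₃ ((universeOf hHD hI hU h₃).prodFin (n + 1) X)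
          ((universeOf hHD hI hU h₃).prodFin n fun i => X i.castSucc)) ≫
        (universeOf hHD hI hU h₃).prj n (fun i => X i.castSucc) i := by
    simp [Universe.prj]
    rfl
  exact (congrArg (BettiUniverse.pull · k) e).trans (BettiUniverse.pull_comp _ _ k)

/-- **Degree transport of the coniveau condition** along the package's `Universe.castCoh` (a cast along a degree
equality): membership of the complexification in `Nʳ` is unchanged. -/
theorem ofRatClass_castCoh_mem_iff (X : Var) {k l : ℕ} (h : k = l) (r : ℕ)
    (z : (universeOf hHD hI hU h₃).Coh X k) :
    ofRatClass (ComplexPoints (Var.scheme hU h₃ X)) l ((universeOf hHD hI hU h₃).castCoh X h z) ∈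
        supportedClasses (Var.scheme hU h₃ X) l r ↔
      ofRatClass (ComplexPoints (Var.scheme hU h₃ X)) k z ∈ supportedClasses (Var.scheme hU h₃ X) k r := by
  subst h
  exact Iff.rfl

end Projections

/-- **Fact F7 `Fact_gysin` holds in the model universe `universeOf hHD hI hU h₃`** (row Fg7 of the COR-CM binder
table), with no further hypothesis: block Gysin maps `gy k = s₀⁻¹ • (p_A)_!` (`exists_blockGysin`) for every
block pair, algebraic classes preserved, projection formula with base change. -/
theorem universeOf_fact_gysin (hHD : exists_isReal_hodgeModel) (hI : hodgePQ_independent_of_hodgeModel)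
    (hU : BallQuotientUniformisedDatum) (h₃ : CMAbelianVarietyRealised) :
    (universeOf hHD hI hU h₃).Fact_gysin := by
  intro F n m Ξ pA pB hbp
  obtain ⟨gy, hgy₁, hgy₂⟩ := exists_blockGysin
    (Var.isSmoothProjective hU h₃ ((universeOf hHD hI hU h₃).cmProd F Ξ))
    (Var.isSmoothProjective hU h₃ ((universeOf hHD hI hU h₃).cmProd F (blkA Ξ)))
    (Var.isSmoothProjective hU h₃ ((universeOf hHD hI hU h₃).cmProd F (blkB Ξ)))
    (dim_prodFin_blocks hHD hI hU h₃ n m fun k => (universeOf hHD hI hU h₃).cmAV F (Ξ k)) pA pB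
    (blockPair_top_ne_zero hHD hI hU h₃ (universeOf hHD hI hU h₃).prj (pull_prj_zero hHD hI hU h₃)
      (pull_prj_last hHD hI hU h₃) (pull_prj_castSucc hHD hI hU h₃) n m
      (fun k => (universeOf hHD hI hU h₃).cmAV F (Ξ k)) pA pB hbp.1 hbp.2)
  refine ⟨gy, fun p z hz ↦ ?_, fun k e ω ↦ hgy₂ k e ω⟩
  exact hgy₁ p _ ((ofRatClass_castCoh_mem_iff hHD hI hU h₃ _ _ (p + Var.dim ((universeOf hHD hI hU h₃).cmProd F (blkB Ξ))) z).2
    ((mem_ratAlgebraicClasses_iff _ _ z).1 hz))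

/-- `Fact_gysin` for the model of record `picardCMUniverse hHD hI h₁ h₃`. -/
theorem picardCMUniverse_fact_gysin (hHD : exists_isReal_hodgeModel) (hI : hodgePQ_independent_of_hodgeModel)
    (h₁ : BallQuotientUniformised) (h₃ : CMAbelianVarietyRealised) :
    (picardCMUniverse hHD hI h₁ h₃).Fact_gysin :=
  universeOf_fact_gysin hHD hI (ballQuotientUniformisedDatum_of h₁) h₃

end Summit.HodgeConjecture.CorCM.Model

end
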